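import Summits.RiemannHypothesis.RiemannHypothesis.Theorems.IntegerScrewCensusDualCellSound
import Summits.RiemannHypothesis.RiemannHypothesis.Theorems.ScrewManifestCertDual

/-!
# Route `IntegerScrew` — kernel checker for the census DUAL certificates (12): the matrix of a certificate

The real matrix `Zmat n Z` of the integer row list `Z`, and three of the four `DualCert` conditions from the checker's data:
`t²·⟨A_t, Z⟩ = C0 + qSum_Z(cos(t·))` for symmetric `Z` (`frob_waveAtom_eq`), `Z ∈ DD*` from `ddDualCheck`
(`inDDDual_of_check`), and `⟨J, Z⟩ = onesPair Z` (`frob_onesMat_eq`).  RH-free; nothing here bears on the truth of RH.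
-/

set_option linter.dupNamespace false
set_option autoImplicit false

namespace Summit.RiemannHypothesis.RiemannHypothesis.Theorems.IntegerScrew.Manifest.Fast

open Finset

/-- The real matrix of the row list `Z` (missing entries `0`). -/
def Zmat (n : ℕ) (Z : List (List ℤ)) : Matrix (Fin n) (Fin n) ℝ := Matrix.of fun i j => (((Z.getD i []).getD j 0 : ℤ) : ℝ)

/-! ### List sums -/

/-- `sumZ` as a `Finset` sum. -/
theorem sumZ_eq_sum : ∀ (l : List ℤ), sumZ l = ∑ k ∈ range l.length, l.getD k 0
  | [] => by simp [sumZ]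
  | z :: zs => by
    rw [sumZ, sumZ_eq_sum zs, List.length_cons, Finset.sum_range_succ']
    simp [add_comm]

/-- `sumZ` of a mapped `range`. -/
theorem sumZ_map_range (n : ℕ) (f : ℕ → ℤ) : sumZ ((List.range n).map f) = ∑ a ∈ range n, f a := by
  rw [sumZ_eq_sum, List.length_map, List.length_range]
  refine Finset.sum_congr rfl fun a ha => ?_
  rw [Finset.mem_range] at ha
  rw [List.getD_eq_getElem _ _ (by simpa using ha)]; simp

/-- `sumZ` of a mapped list. -/
theorem sumZ_map {α : Type*} (l : List α) (f : α → ℤ) (d : α) : sumZ (l.map f) = ∑ a ∈ range l.length, f (l.getD a d) := by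
  rw [sumZ_eq_sum, List.length_map]
  refine Finset.sum_congr rfl fun a ha => ?_
  rw [Finset.mem_range] at ha
  rw [List.getD_eq_getElem _ _ (by simpa using ha), List.getD_eq_getElem _ _ ha]; simp

/-- A row of a square `Z` has length `n`. -/
theorem row_length {Z : List (List ℤ)} (hsq : ∀ row ∈ Z, row.length = Z.length) {a : ℕ} (ha : a < Z.length) :
    (Z.getD a []).length = Z.length := by
  rw [List.getD_eq_getElem _ _ ha]; exact hsq _ (List.getElem_mem ha)

/-- `onesPair Z = Σ_{a,b<n} Z_ab`. -/
theorem onesPair_eq (Z : List (List ℤ)) (hsq : ∀ row ∈ Z, row.length = Z.length) :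
    onesPair Z = ∑ a ∈ range Z.length, ∑ b ∈ range Z.length, (Z.getD a []).getD b 0 := by
  unfold onesPair
  rw [sumZ_map Z sumZ []]
  refine Finset.sum_congr rfl fun a ha => ?_
  rw [Finset.mem_range] at ha
  rw [sumZ_eq_sum, row_length hsq ha]

/-- `Σ diagZ Z = Σ_a Z_aa`. -/
theorem sumZ_diagZ (Z : List (List ℤ)) : sumZ (diagZ Z) = ∑ a ∈ range Z.length, (Z.getD a []).getD a 0 := by
  unfold diagZ; exact sumZ_map_range _ _

/-- Entries of `diagZ`. -/
theorem getD_diagZ (Z : List (List ℤ)) {a : ℕ} (ha : a < Z.length) : (diagZ Z).getD a 0 = (Z.getD a []).getD a 0 := by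
  unfold diagZ
  rw [List.getD_eq_getElem _ _ (by simpa using ha)]; simp

/-! ### `⟨A_t, Z⟩` and `⟨J, Z⟩` -/

/-- Upper/lower triangle swap: `Σ_{i<n} Σ_{i<j<n} g i j = Σ_{j<n} Σ_{i<j} g i j`. -/
theorem sum_upper_swap (n : ℕ) (g : ℕ → ℕ → ℝ) :
    ∑ i ∈ range n, ∑ j ∈ Ico (i + 1) n, g i j = ∑ j ∈ range n, ∑ i ∈ range j, g i j := by
  refine Finset.sum_comm' fun i j => ?_
  simp only [Finset.mem_range, Finset.mem_Ico]
  omega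

/-- Square split: `Σ_{i<n} Σ_{j<n} g = Σ_i (Σ_{j<i} g i j + g i i + Σ_{i<j<n} g i j)`. -/
theorem sum_square_split (n : ℕ) (g : ℕ → ℕ → ℝ) :
    ∑ i ∈ range n, ∑ j ∈ range n, g i j = ∑ i ∈ range n, (∑ j ∈ range i, g i j + g i i + ∑ j ∈ Ico (i + 1) n, g i j) := by
  refine Finset.sum_congr rfl fun i hi => ?_
  rw [Finset.mem_range] at hi
  rw [← Finset.sum_range_succ, ← Finset.sum_range_add_sum_Ico _ (by omega : i + 1 ≤ n)]

/-- The trigonometric identity behind `⟨A_t, Z⟩` for a symmetric kernel `z`. -/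
theorem wave_sum_identity (n : ℕ) (z : ℕ → ℕ → ℝ) (x : ℕ → ℝ) (t : ℝ) (hzs : ∀ a b, a < n → b < n → z a b = z b a) :
    ∑ i ∈ range n, ∑ j ∈ range n, ((1 - Real.cos (t * x i)) - Real.cos (t * x j) + Real.cos (t * (x i - x j))) * z i j =
      (∑ i ∈ range n, ∑ j ∈ range n, z i j + ∑ i ∈ range n, z i i) +
        ∑ i ∈ range n, (∑ j ∈ range i, 2 * z i j * Real.cos (t * (x i - x j)) + -2 * (∑ j ∈ range n, z i j) * Real.cos (t * x i)) := by
  have hsplit : ∀ i ∈ range n, ∑ j ∈ range n, ((1 - Real.cos (t * x i)) - Real.cos (t * x j) + Real.cos (t * (x i - x j))) * z i j =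
      ∑ j ∈ range n, z i j - Real.cos (t * x i) * ∑ j ∈ range n, z i j - ∑ j ∈ range n, Real.cos (t * x j) * z i j +
        ∑ j ∈ range n, Real.cos (t * (x i - x j)) * z i j := by
    intro i _
    rw [Finset.mul_sum, ← Finset.sum_sub_distrib, ← Finset.sum_sub_distrib, ← Finset.sum_add_distrib]
    exact Finset.sum_congr rfl fun j _ => by ring
  rw [Finset.sum_congr rfl hsplit, Finset.sum_add_distrib, Finset.sum_sub_distrib, Finset.sum_sub_distrib]
  have hcol : ∑ i ∈ range n, ∑ j ∈ range n, Real.cos (t * x j) * z i j = ∑ i ∈ range n, Real.cos (t * x i) * ∑ j ∈ range n, z i j := by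
    rw [Finset.sum_comm]
    refine Finset.sum_congr rfl fun j hj => ?_
    rw [Finset.mul_sum]
    refine Finset.sum_congr rfl fun i hi => ?_
    rw [hzs i j (Finset.mem_range.1 hi) (Finset.mem_range.1 hj)]
  have hup : ∑ j ∈ range n, ∑ i ∈ range j, Real.cos (t * (x i - x j)) * z i j =
      ∑ i ∈ range n, ∑ j ∈ range i, Real.cos (t * (x i - x j)) * z i j := by
    refine Finset.sum_congr rfl fun j hj => Finset.sum_congr rfl fun i hi => ?_
    rw [hzs i j ((Finset.mem_range.1 hi).trans (Finset.mem_range.1 hj)) (Finset.mem_range.1 hj), ← Real.cos_neg]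
    congr 1; ring
  have hdiag : ∑ i ∈ range n, Real.cos (t * (x i - x i)) * z i i = ∑ i ∈ range n, z i i :=
    Finset.sum_congr rfl fun i _ => by simp
  have hcd : ∑ i ∈ range n, ∑ j ∈ range n, Real.cos (t * (x i - x j)) * z i j =
      ∑ i ∈ range n, z i i + 2 * ∑ i ∈ range n, ∑ j ∈ range i, Real.cos (t * (x i - x j)) * z i j := by
    rw [sum_square_split, Finset.sum_add_distrib, Finset.sum_add_distrib, sum_upper_swap, hup, hdiag]; ring
  rw [hcol, hcd, Finset.sum_add_distrib]
  have h2 : ∑ i ∈ range n, ∑ j ∈ range i, 2 * z i j * Real.cos (t * (x i - x j)) =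
      2 * ∑ i ∈ range n, ∑ j ∈ range i, Real.cos (t * (x i - x j)) * z i j := by
    rw [Finset.mul_sum]
    refine Finset.sum_congr rfl fun i _ => ?_
    rw [Finset.mul_sum]
    exact Finset.sum_congr rfl fun j _ => by ring
  have h3 : ∑ i ∈ range n, -2 * (∑ j ∈ range n, z i j) * Real.cos (t * x i) = -2 * ∑ i ∈ range n, Real.cos (t * x i) * ∑ j ∈ range n, z i j := by
    rw [Finset.mul_sum]
    exact Finset.sum_congr rfl fun i _ => by ring
  rw [h2, h3]; ring

/-- `frob` of two `ℕ`-indexed kernels as `range` sums. -/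
theorem frob_of_nat (n : ℕ) (f g : ℕ → ℕ → ℝ) :
    frob (Matrix.of fun i j : Fin n => f i j) (Matrix.of fun i j : Fin n => g i j) = ∑ i ∈ range n, ∑ j ∈ range n, f i j * g i j := by
  unfold frob
  simp only [Matrix.of_apply]
  rw [Fin.sum_univ_eq_sum_range (fun i => ∑ j : Fin n, f i j * g i j) n]
  exact Finset.sum_congr rfl fun i _ => Fin.sum_univ_eq_sum_range (fun j => f i j * g i j) n

/-- The wave atom as an `ℕ`-indexed kernel. -/
theorem waveAtom_of (n : ℕ) (t : ℝ) : waveAtom n t = Matrix.of fun i j : Fin n =>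
    (fun a b : ℕ => (1 - Real.cos (t * Real.log ((a + 2 : ℕ) : ℝ)) - Real.cos (t * Real.log ((b + 2 : ℕ) : ℝ)) +
      Real.cos (t * (Real.log ((a + 2 : ℕ) : ℝ) - Real.log ((b + 2 : ℕ) : ℝ)))) / t ^ 2) i j := by
  ext i j; simp [waveAtom, node]

/-- `Zmat` as an `ℕ`-indexed kernel. -/
theorem Zmat_of (n : ℕ) (Z : List (List ℤ)) :
    Zmat n Z = Matrix.of fun i j : Fin n => (fun a b : ℕ => (((Z.getD a []).getD b 0 : ℤ) : ℝ)) i j := rfl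

/-- `C0 + qSum_Z(cos(t·))` written out as double sums. -/
theorem constQ_add_qSum_eq {n : ℕ} (Z : List (List ℤ)) (hsq : ∀ row ∈ Z, row.length = Z.length) (hn : Z.length = n) (t : ℝ) :
    (constQ Z : ℝ) + qSum Z (fun a => Real.log ((a + 2 : ℕ) : ℝ)) (fun μ => Real.cos (t * μ)) =
      (∑ i ∈ range n, ∑ j ∈ range n, (((Z.getD i []).getD j 0 : ℤ) : ℝ) + ∑ i ∈ range n, (((Z.getD i []).getD i 0 : ℤ) : ℝ)) +
        ∑ i ∈ range n, (∑ j ∈ range i, 2 * (((Z.getD i []).getD j 0 : ℤ) : ℝ) *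
            Real.cos (t * (Real.log ((i + 2 : ℕ) : ℝ) - Real.log ((j + 2 : ℕ) : ℝ))) +
          -2 * (∑ j ∈ range n, (((Z.getD i []).getD j 0 : ℤ) : ℝ)) * Real.cos (t * Real.log ((i + 2 : ℕ) : ℝ))) := by
  have hrow : ∀ i ∈ range n, (sumZ (Z.getD i []) : ℝ) = ∑ j ∈ range n, (((Z.getD i []).getD j 0 : ℤ) : ℝ) := by
    intro i hi
    rw [sumZ_eq_sum, row_length hsq (by rw [hn]; exact Finset.mem_range.1 hi), hn]; push_cast; rfl
  unfold qSum constQ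
  rw [onesPair_eq Z hsq, sumZ_diagZ, hn]
  push_cast
  congr 1
  refine Finset.sum_congr rfl fun i hi => ?_
  rw [hrow i hi]

/-- **`t²·⟨A_t, Z⟩ = C0 + qSum_Z(cos(t·))`** for a symmetric square `Z` of size `n` and `t ≠ 0` (nodes `ν_a = log(a+2)`). -/
theorem frob_waveAtom_eq {n : ℕ} (Z : List (List ℤ)) (hsq : ∀ row ∈ Z, row.length = Z.length) (hn : Z.length = n)
    (hsymm : ∀ a b, a < n → b < n → (Z.getD a []).getD b 0 = (Z.getD b []).getD a 0) {t : ℝ} (ht : t ≠ 0) :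
    t ^ 2 * frob (waveAtom n t) (Zmat n Z) =
      (constQ Z : ℝ) + qSum Z (fun a => Real.log ((a + 2 : ℕ) : ℝ)) fun μ => Real.cos (t * μ) := by
  have hf := frob_of_nat n (fun a b : ℕ => (1 - Real.cos (t * Real.log ((a + 2 : ℕ) : ℝ)) - Real.cos (t * Real.log ((b + 2 : ℕ) : ℝ)) +
      Real.cos (t * (Real.log ((a + 2 : ℕ) : ℝ) - Real.log ((b + 2 : ℕ) : ℝ)))) / t ^ 2)
    (fun a b : ℕ => (((Z.getD a []).getD b 0 : ℤ) : ℝ))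
  have hid := wave_sum_identity n (fun a b => (((Z.getD a []).getD b 0 : ℤ) : ℝ)) (fun a => Real.log ((a + 2 : ℕ) : ℝ)) t
    (fun a b ha hb => by exact_mod_cast hsymm a b ha hb)
  rw [waveAtom_of, Zmat_of, hf, constQ_add_qSum_eq Z hsq hn t, ← hid, Finset.mul_sum]
  refine Finset.sum_congr rfl fun i _ => ?_
  rw [Finset.mul_sum]
  refine Finset.sum_congr rfl fun j _ => ?_
  field_simp

/-- **`⟨J, Z⟩ = onesPair Z`.** -/
theorem frob_onesMat_eq {n : ℕ} (Z : List (List ℤ)) (hsq : ∀ row ∈ Z, row.length = Z.length) (hn : Z.length = n) :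
    frob (onesMat n) (Zmat n Z) = (onesPair Z : ℝ) := by
  unfold frob
  rw [onesPair_eq Z hsq, hn]
  simp only [onesMat, Zmat, Matrix.of_apply, one_mul]
  push_cast
  rw [Fin.sum_univ_eq_sum_range (fun i => ∑ j : Fin n, (((Z.getD i []).getD j 0 : ℤ) : ℝ)) n]
  refine Finset.sum_congr rfl fun i _ => ?_
  exact Fin.sum_univ_eq_sum_range (fun j => (((Z.getD i []).getD j 0 : ℤ) : ℝ)) n

/-! ### `Z ∈ DD*` -/

/-- Unrolling `ddRowCheck`. -/
theorem ddRowCheck_spec (zaa : ℤ) : ∀ (zs ds : List ℤ), ddRowCheck zaa zs ds = true →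
    ∀ k, k < zs.length → 2 * |zs.getD k 0| ≤ zaa + ds.getD k 0
  | [], _, _, k, hk => by simp at hk
  | _ :: _, [], h, _, _ => by simp [ddRowCheck] at h
  | z :: zs, d :: ds, h, k, hk => by
    simp only [ddRowCheck, Bool.and_eq_true, decide_eq_true_eq] at h
    cases k with
    | zero => simpa using h.1
    | succ k =>
      simp only [List.getD_cons_succ]
      exact ddRowCheck_spec zaa zs ds h.2 k (by simpa using hk)

/-- Unrolling `ddDualGo`. -/
theorem ddDualGo_spec (diag : List ℤ) : ∀ (zrs : List (List ℤ)) (ds : List ℤ), ddDualGo diag zrs ds = true →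
    ∀ a, a < zrs.length → 0 ≤ ds.getD a 0 ∧ ddRowCheck (ds.getD a 0) (zrs.getD a []) diag = true
  | [], _, _, a, ha => by simp at ha
  | _ :: _, [], h, _, _ => by simp [ddDualGo] at h
  | zr :: zrs, d :: ds, h, a, ha => by
    simp only [ddDualGo, Bool.and_eq_true, decide_eq_true_eq] at h
    cases a with
    | zero => simpa using ⟨h.1.1, h.1.2⟩
    | succ a =>
      simp only [List.getD_cons_succ]
      exact ddDualGo_spec diag zrs ds h.2 a (by simpa using ha)

/-- **`Z ∈ DD*`** from `ddDualCheck`. -/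
theorem inDDDual_of_check {n : ℕ} (Z : List (List ℤ)) (hsq : ∀ row ∈ Z, row.length = Z.length) (hn : Z.length = n)
    (hdd : ddDualCheck Z = true) : InDDDual (Zmat n Z) := by
  unfold ddDualCheck at hdd
  have hspec := ddDualGo_spec (diagZ Z) Z (diagZ Z) hdd
  constructor
  · intro i
    have hi : (i : ℕ) < Z.length := by rw [hn]; exact i.isLt
    have := (hspec i hi).1
    rw [getD_diagZ Z hi] at this
    simp only [Zmat, Matrix.of_apply]
    exact_mod_cast this
  · intro i j _
    have hi : (i : ℕ) < Z.length := by rw [hn]; exact i.isLt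
    have hj : (j : ℕ) < Z.length := by rw [hn]; exact j.isLt
    obtain ⟨_, hrow⟩ := hspec i hi
    rw [getD_diagZ Z hi] at hrow
    have h := ddRowCheck_spec _ _ _ hrow j (by rw [row_length hsq hi]; exact hj)
    rw [getD_diagZ Z hj] at h
    simp only [Zmat, Matrix.of_apply]
    have h' : ((2 * |(Z.getD (i : ℕ) []).getD (j : ℕ) 0| : ℤ) : ℝ) ≤
        (((Z.getD (i : ℕ) []).getD (i : ℕ) 0 + (Z.getD (j : ℕ) []).getD (j : ℕ) 0 : ℤ) : ℝ) := by exact_mod_cast h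
    push_cast at h'
    exact h'

/-! ### Symmetry from `symmCheck` -/

/-- `colZ` entries. -/
theorem getD_colZ (Z : List (List ℤ)) (c : ℕ) {b : ℕ} (hb : b < Z.length) : (colZ Z c).getD b 0 = (Z.getD b []).getD c 0 := by
  unfold colZ
  rw [List.getD_eq_getElem _ _ (by simpa using hb), List.getElem_map, List.getD_eq_getElem _ _ hb]

/-- **`symmCheck` gives a square symmetric `Z`.** -/
theorem symm_of_check (Z : List (List ℤ)) (h : symmCheck Z = true) :
    (∀ row ∈ Z, row.length = Z.length) ∧ ∀ a b, a < Z.length → b < Z.length → (Z.getD a []).getD b 0 = (Z.getD b []).getD a 0 := by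
  unfold symmCheck at h
  simp only [Bool.and_eq_true, List.all_eq_true, decide_eq_true_eq, List.mem_range] at h
  refine ⟨h.2, fun a b ha hb => ?_⟩
  rw [h.1 a ha, getD_colZ Z a hb]

end Summit.RiemannHypothesis.RiemannHypothesis.Theorems.IntegerScrew.Manifest.Fast
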